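import Literature.NumberTheory.GaloisRepresentations.PeuRamifieCriterionProofs
import Literature.NumberTheory.GaloisRepresentations.CubicEisensteinRamificationBreakProofs
import Mathlib.RingTheory.RootsOfUnity.CyclotomicUnits
import Mathlib.RingTheory.Polynomial.Cyclotomic.Eval
import HarnessLib

/-!
# A Kummer extension `F(ζ_p, x^{1/p})/F` with `p ∤ v_F(x)` is *très ramifié*: it has an upper
# ramification break `> 1` (Serre, Duke 54 (1987) §2.4; Serre, *Local Fields*, Ch. IV §§1–4)

`Proofs` file (theorems only: no definition, no named fact, no instance, no notation, no `sorry`) in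
topic `NumberTheory/GaloisRepresentations`; sequel of `PeuRamifieCriterionProofs` (the `≤ 1` direction:
«the tree has the transvection but not the jump», `GoodReductionPeuRamifieProofs` docstring) and of the
cubic templates `CubicEisensteinRamification*Proofs`.  Written by the cell `pub/bsd-print-x9`, seat
`bsd-line-x9-p2` (g5), road (R-g) of the shared μ-crux's STUB A input (H5B-P-ANOM)/(A1u), leaf (β2):
«the extension class `c̄_E` of `0 → Fil_w E[p] → E[p] → gr_w → 0` over `K_w` is the Kummer class of a
UNIT» = peu ramifié (tree: `isPeuRamifie_restrictField_of_not_dvd_frobeniusTraceAt`) + THIS file.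

Serre 1987, §2.4 (ii): for `ρ̄|I = (χ *; 0 1)` wild, the field cut out is `K_t(x_1^{1/p}, …)`; `ρ̄` is
*peu ramifiée* iff the `x_i` can be taken UNITS, *très ramifiée* otherwise; in upper-numbering terms
(the tree's `ModPGaloisRep.IsPeuRamifie`: `I_F^u` acts trivially for all `u > 1`) this is the classical
computation of the breaks of `F(ζ_p, x^{1/p})/F`:

* §1 `exists_one_lt_mem_upperRamificationSubgroup` — Herbrand, abstract LOWER bound (mirror of
  `upperRamificationSubgroup_eq_bot_of_card_mul_le`): `σ ∈ G_s` and `#G_0 < s·#G_s` give `σ ∈ G^{φ(s)}`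
  with `φ(s) > 1` (`g₀(φ(s)+1) = Σ_{i≤s} gᵢ ≥ g₀ + s g_s`).
* §2 `exists_isUnit_sub_one_pow_eq_natCast_mul_of_isPrimitiveRoot` — `(ζ - 1)^{p-1} = p · unit` in any
  domain (`p = Φ_p(1) = ∏ (1 - ζ^j)`, cyclotomic units).
* §3 `exists_one_lt_mem_upperRamificationSubgroup_smul_ne_of_kummer` — THE LAYER COMPUTATION.  `F` a
  characteristic-`0` non-archimedean local field with `p` a UNIFORMISER (`F/ℚ_p` unramified), `E/F` finite
  Galois inside `F̄` containing and generated by a primitive `p`-th root of unity `ζ` and an integer `y` with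
  `y^p = v p^c`, `v ∈ 𝒪_F^×`, `p ∤ c`.  At THE prime `𝔓_E` (`absMaximalIdeal ∩ E`): `#Gal(E/F) ≤ (p-1)p`
  (`g ↦ (gζ, gy)` is injective); `π := y^a/(ζ-1)^b` with `a(p-1)c = 1 + bp` satisfies
  `π^{p(p-1)} · w^{bp} = v^{a(p-1)} · p` in `𝒪_E`, whence `p(p-1)·v(π) = e ≤ p(p-1)`, so `e = p(p-1)`,
  `v(π) = 1`, `v(ζ-1) = p`; Cauchy gives `τ ∈ G_0` of order `p`, which fixes `ζ`
  (`IsPrimitiveRoot.autToPow`: `(ℤ/p)^×` has order prime to `p`) and sends `y ↦ ζ^i y`, `ζ^i ≠ 1`; then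
  `τπ - π = (ζ^{ia} - 1)π` has order `p + 1`, i.e. `τ ∈ G_p` (uniformiser criterion
  `mem_ramificationSubgroup_iff_of_mem_inertia`); `G_p` is a non-trivial `p`-group so `#G_p ≥ p`, and
  `#G_0 = p(p-1) < p·#G_p`: by §1, `τ ∈ G^u` with `u = φ(p) = p/(p-1) > 1`.
* §4 **`exists_one_lt_mem_absUpperInertia_smul_ne_of_pow_eq`** — the absolute form: for `y ∈ F̄` with
  `y^p = v·p^c`, `p ∤ c`: **`∃ u > 1, ∃ σ ∈ I_F^u, σ y ≠ y`** (layer `E = F(rootSet (X^p - x))`, Galois by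
  `IsGalois.of_separable_splitting_field`; lift by the tree's Herbrand fact
  `absUpperInertia_map_absRestrictNormalHom_holds`); contrapositives `dvd_of_forall_absUpperInertia_smul_eq`
  (`p ∣ c`) and **`exists_eq_unit_mul_pow_of_forall_absUpperInertia_smul_eq`** («peu ramifié ⇒
  `x = unit · z^p`», the unit-class statement).

HONEST FRAMING: classical local ramification theory in the tree's currency (`absUpperInertia`,
`upperRamificationSubgroup`, `herbrandPhi`, `ord`); hypothesis `p` uniformiser (`e(F/ℚ_p) = 1`, as in
`isPeuRamifie_restrictField_of_not_dvd_frobeniusTraceAt`) — the ramified-base version (breaks scaled by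
`e_F`) is NOT treated; `p = 2` allowed.  Proves no case of BSD; no summit statement is proved.

## References

* J.-P. Serre, *Sur les représentations modulaires de degré 2 de Gal(ℚ̄/ℚ)*, Duke Math. J. 54 (1987),
  §2.4 (ii) (peu/très ramifié), §2.8. [Serre1987]
* J.-P. Serre, *Local Fields*, GTM 67 (1979), Ch. IV §1 (Lemma 1, Prop. 2–5: `i_G`, `e = #G_0`), §2
  (Cor. 3 of Prop. 7: `G_1` is a `p`-group), §3 (pp. 73–74: `φ`, `G^{φ(u)} = G_u`, Prop. 14, Remark 1),
  §4 (Prop. 17–18: cyclotomic case). [SerreLocalFields1979]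
* B. Edixhoven, Invent. Math. 109 (1992), §2 (peu ramifié ⟺ finite flat). [Edixhoven1992]
-/

noncomputable section

open scoped Pointwise Valued
open Field ValuativeRel Polynomial

namespace Literature.NumberTheory.GaloisRepresentations

universe u

/-! ### §1 Herbrand: an upper break `> 1` from a non-trivial deep `G_s` -/

section Herbrand

variable {S : Type*} [CommRing S] (𝔓 : Ideal S) (G : Type*) [Group G] [MulSemiringAction G S]
  [Finite G]

/-- `g₀ + s·g_s ≤ Σ_{i=0}^{s} gᵢ` (`gᵢ = #G_i` is decreasing in `i`).  Serre, *Local Fields*,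
IV §3, p. 73. [cite: SerreLocalFields1979, Ch. IV §3 (p. 73)] -/
theorem card_add_mul_card_le_sum_card_ramificationSubgroup (s : ℕ) :
    (Nat.card (𝔓.ramificationSubgroup G 0) : ℝ) + s * Nat.card (𝔓.ramificationSubgroup G s) ≤
      ∑ i ∈ Finset.range (s + 1), (Nat.card (𝔓.ramificationSubgroup G i) : ℝ) := by
  rw [Finset.sum_range_succ']
  have h : ∀ i ∈ Finset.range s, Nat.card (𝔓.ramificationSubgroup G s) ≤
      Nat.card (𝔓.ramificationSubgroup G (i + 1)) := fun i hi ↦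
    Subgroup.card_le_of_le
      (𝔓.ramificationSubgroup_antitone G (Nat.succ_le_of_lt (Finset.mem_range.mp hi)))
  calc (Nat.card (𝔓.ramificationSubgroup G 0) : ℝ) + s * Nat.card (𝔓.ramificationSubgroup G s)
      = ∑ _i ∈ Finset.range s, (Nat.card (𝔓.ramificationSubgroup G s) : ℝ) +
          Nat.card (𝔓.ramificationSubgroup G 0) := by
        rw [Finset.sum_const, Finset.card_range, nsmul_eq_mul]; ring
    _ ≤ ∑ i ∈ Finset.range s, (Nat.card (𝔓.ramificationSubgroup G (i + 1)) : ℝ) +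
          Nat.card (𝔓.ramificationSubgroup G 0) := by
        gcongr with i hi; exact h i hi

/-- If `g₀ < s·g_s` then `φ(s) > 1` (`g₀ (φ(s) + 1) = Σ_{i=0}^{s} gᵢ ≥ g₀ + s g_s > 2 g₀`).
Serre, *Local Fields*, IV §3, p. 73. [cite: SerreLocalFields1979, Ch. IV §3 (p. 73)] -/
theorem one_lt_herbrandPhi_natCast_of_card_lt_mul {s : ℕ}
    (hcard : Nat.card (𝔓.ramificationSubgroup G 0) < s * Nat.card (𝔓.ramificationSubgroup G s)) :
    1 < herbrandPhi 𝔓 G s := by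
  have h0 : (0 : ℝ) < Nat.card (𝔓.ramificationSubgroup G 0) := Nat.cast_pos.mpr Nat.card_pos
  have h := card_mul_herbrandPhi_natCast_add_one 𝔓 G s
  have hsum := card_add_mul_card_le_sum_card_ramificationSubgroup 𝔓 G s
  have hc : (Nat.card (𝔓.ramificationSubgroup G 0) : ℝ) <
      (s : ℝ) * Nat.card (𝔓.ramificationSubgroup G s) := by exact_mod_cast hcard
  rw [← h] at hsum
  nlinarith

/-- **An upper break `> 1` from the lower filtration.**  If `σ ∈ G_s` and `g₀ < s · g_s`, then
`σ ∈ G^u` for `u = φ(s) > 1` (`G^{φ(s)} = G_s`).  Serre, *Local Fields*, IV §3 (pp. 73–74).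
[cite: SerreLocalFields1979, Ch. IV §3 (pp. 73–74)] -/
theorem exists_one_lt_mem_upperRamificationSubgroup {s : ℕ} {σ : G}
    (hσ : σ ∈ 𝔓.ramificationSubgroup G s)
    (hcard : Nat.card (𝔓.ramificationSubgroup G 0) < s * Nat.card (𝔓.ramificationSubgroup G s)) :
    ∃ u : ℝ, 1 < u ∧ σ ∈ upperRamificationSubgroup 𝔓 G u := by
  refine ⟨herbrandPhi 𝔓 G s, one_lt_herbrandPhi_natCast_of_card_lt_mul 𝔓 G hcard, ?_⟩
  rw [upperRamificationSubgroup_herbrandPhi_holds 𝔓 G (s : ℝ), Nat.ceil_natCast]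
  exact hσ

end Herbrand

/-! ### §2 Cyclotomic units: `(ζ - 1)^{p-1} = p · unit` -/

section CyclotomicUnit

variable {B : Type*} [CommRing B] [IsDomain B] {p : ℕ} [hp : Fact p.Prime] {ζ : B}

/-- **`(ζ - 1)^{p-1}` and `p` are associated** for a primitive `p`-th root of unity `ζ` in a domain:
`p = Φ_p(1) = ∏_{μ primitive} (1 - μ)` and every `1 - μ = 1 - ζ^j`, `p ∤ j`, is associated to `ζ - 1`
(cyclotomic units).  Washington, *Cyclotomic Fields*, Lemma 1.4 / Serre, *Local Fields*, IV §4.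
[cite: SerreLocalFields1979, Ch. IV §4 Prop. 17] -/
theorem exists_isUnit_sub_one_pow_eq_natCast_mul_of_isPrimitiveRoot (hζ : IsPrimitiveRoot ζ p) :
    ∃ w : B, IsUnit w ∧ (ζ - 1) ^ (p - 1) = (p : B) * w := by
  classical
  have hp1 : p.Prime := hp.out
  -- `∏_{μ primitive} (1 - μ) = p`
  have hprod : ∏ μ ∈ primitiveRoots p B, (1 - μ) = (p : B) := by
    have h := Polynomial.eval_one_cyclotomic_prime (R := B) (p := p)
    rw [Polynomial.cyclotomic_eq_prod_X_sub_primitiveRoots hζ, Polynomial.eval_prod] at h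
    simpa only [Polynomial.eval_sub, Polynomial.eval_X, Polynomial.eval_C] using h
  -- every factor is associated to `ζ - 1`
  have hassoc : ∀ μ ∈ primitiveRoots p B, Associated (ζ - 1) (1 - μ) := by
    intro μ hμ
    have hμ' : IsPrimitiveRoot μ p := (mem_primitiveRoots hp1.pos).mp hμ
    obtain ⟨j, -, rfl⟩ := hζ.eq_pow_of_pow_eq_one hμ'.pow_eq_one
    have hj : j.Coprime p := (hζ.pow_iff_coprime hp1.pos j).mp hμ'
    exact (hζ.associated_sub_one_pow_sub_one_of_coprime hj).trans
      ((Associated.refl _).neg_right.trans (by rw [neg_sub]))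
  -- the product is associated to `(ζ - 1)^{p-1}`
  have hcard : (primitiveRoots p B).card = p - 1 := by
    rw [hζ.card_primitiveRoots, Nat.totient_prime hp1]
  have hA : Associated ((ζ - 1) ^ (p - 1)) (∏ μ ∈ primitiveRoots p B, (1 - μ)) := by
    rw [← hcard, ← Finset.prod_const]
    rw [← Associates.mk_eq_mk_iff_associated, ← Associates.finsetProd_mk,
      ← Associates.finsetProd_mk]
    refine Finset.prod_congr rfl fun μ hμ ↦ ?_
    exact Associates.mk_eq_mk_iff_associated.mpr (hassoc μ hμ)
  rw [hprod] at hA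
  obtain ⟨u, hu⟩ := hA.symm
  exact ⟨u, u.isUnit, hu.symm⟩

end CyclotomicUnit

/-! ### §3 The layer `E ∋ ζ_p, y` with `y^p = v p^c`, `p ∤ c`: an element of `G_p` moving `y` -/

section Layer

open IsNonarchimedeanLocalField

variable (F : Type u) [Field F] [ValuativeRel F] [TopologicalSpace F] [IsNonarchimedeanLocalField F]
  [CharZero F]

/-- `v_𝔓` only depends on the element up to units. [folklore] -/
private theorem ord_eq_of_associated {B : Type*} [CommRing B] [IsDedekindDomain B] (P : Ideal B)
    {x y : B} (h : Associated x y) : ord P x = ord P y := by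
  unfold ord
  rw [Ideal.span_singleton_eq_span_singleton.mpr h]

omit [CharZero F] in
/-- The residue characteristic of `F` is `p` when `p` is a uniformiser. [folklore] -/
private theorem ringChar_residueField_eq_of_irreducible {p : ℕ} [hp : Fact p.Prime]
    (hirr : Irreducible ((p : ℕ) : 𝒪[F])) : ringChar 𝓀[F] = p := by
  have hmem : ((p : ℕ) : 𝒪[F]) ∈ 𝓂[F] := (IsLocalRing.mem_maximalIdeal _).mpr hirr.not_isUnit
  have h0 : ((p : ℕ) : 𝓀[F]) = 0 := by
    rw [← map_natCast (IsLocalRing.residue 𝒪[F]), IsLocalRing.residue_eq_zero_iff]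
    exact hmem
  have hdvd : ringChar 𝓀[F] ∣ p := (ringChar.spec _ p).mp h0
  exact (Nat.prime_dvd_prime_iff_eq (ringChar_residueField_prime (F := F)) hp.out).mp hdvd

set_option maxHeartbeats 800000 in
/-- **The layer computation** (Serre, *Local Fields*, IV §§1–3; Serre 1987 §2.4 «très ramifié»).
Let `E/F` be a finite Galois subextension of `F̄` of degree `≤ p(p-1)`, `p` a uniformiser of `F`,
containing a primitive `p`-th root of unity `ζ` and an integer `y` with `y^p = v·p^c`, `v ∈ 𝒪_F^×`, `p ∤ c`,
and generated by them (`hgen`).  Then at THE prime `𝔓_E`: `e = p(p-1)`, `π = y^a/(ζ-1)^b`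
(`a(p-1)c = 1 + bp`) is a uniformiser, an inertia element `τ` of order `p` fixes `ζ`, sends `y ↦ ζ^i y`
(`ζ^i ≠ 1`) and has `i_G(τ) = v(τπ - π) = v((ζ^{ia}-1)π) = p + 1`, so `τ ∈ G_p`; as `#G_p ≥ p` and
`#G_0 = p(p-1) < p·#G_p`, Herbrand gives `τ ∈ G^u` with `u = φ(p) > 1`.
[cite: SerreLocalFields1979, Ch. IV §1 Prop. 2–5, §2 Cor. 3, §3 (pp. 73–74)] [cite: Serre1987, §2.4] -/
theorem exists_one_lt_mem_upperRamificationSubgroup_smul_ne_of_kummer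
    (E : IntermediateField F (AlgebraicClosure F)) [FiniteDimensional F E] [IsGalois F E]
    {p : ℕ} [hp : Fact p.Prime] (hirr : Irreducible ((p : ℕ) : 𝒪[F]))
    (v : 𝒪[F]ˣ) {c : ℕ} (hc : ¬ p ∣ c)
    {ζ y : integralClosure 𝒪[F] E} (hζ : IsPrimitiveRoot ζ p)
    (hy : y ^ p = algebraMap 𝒪[F] (integralClosure 𝒪[F] E) ((v : 𝒪[F]) * (p : 𝒪[F]) ^ c))
    (hgen : ∀ g : E ≃ₐ[F] E, g • ζ = ζ → g • y = y → g = 1) :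
    ∃ u : ℝ, 1 < u ∧ ∃ τ ∈ upperRamificationSubgroup
        ((absMaximalIdeal F).comap (E.integralClosureToAbsIntegers 𝒪[F])) (E ≃ₐ[F] E) u,
      τ • y ≠ y := by
  classical
  set 𝔔 : Ideal (integralClosure 𝒪[F] E) :=
    (absMaximalIdeal F).comap (E.integralClosureToAbsIntegers 𝒪[F]) with h𝔔def
  set G := E ≃ₐ[F] E with hGdef
  have hp1 : p.Prime := hp.out
  haveI : Fact (1 < p) := ⟨hp1.one_lt⟩
  -- instances
  haveI : (absMaximalIdeal F).IsMaximal := absMaximalIdeal_isMaximal_holds F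
  haveI : Finite (𝒪[F] ⧸ (absMaximalIdeal F).under 𝒪[F]) := finite_quotient_under_absMaximalIdeal F
  haveI h𝔔max : 𝔔.IsMaximal :=
    isMaximal_comap_integralClosureToAbsIntegers 𝒪[F] (absMaximalIdeal F) E
  haveI := isSeparable_residue_comap 𝒪[F] (absMaximalIdeal F) E
  haveI : IsDedekindDomain (integralClosure 𝒪[F] E) :=
    IsIntegralClosure.isDedekindDomain 𝒪[F] F E (integralClosure 𝒪[F] E)
  have h𝔔0 : 𝔔 ≠ ⊥ := comap_absMaximalIdeal_ne_bot F E
  -- `e = #G_0`, `v_𝔔(p) = e`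
  set e := Nat.card (𝔔.inertia G) with hedef
  have he : (𝔔.under 𝒪[F]).ramificationIdx' 𝔔 = e :=
    ramificationIdx'_under_base_eq_card_inertia (K := F) 𝔔 h𝔔0
  have hunder : 𝔔.under 𝒪[F] = 𝓂[F] := by
    rw [h𝔔def, under_comap_integralClosureToAbsIntegers, under_absMaximalIdeal_holds F]
  have hordp : ord 𝔔 ((p : ℕ) : integralClosure 𝒪[F] E) = (e : ℕ∞) := by
    rw [← map_natCast (algebraMap 𝒪[F] (integralClosure 𝒪[F] E)), ord_algebraMap (K := F) 𝔔 h𝔔0,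
      he, hunder, ord_eq_one _ ((IsLocalRing.mem_maximalIdeal _).mpr hirr.not_isUnit)
        (not_mem_maximalIdeal_sq_of_irreducible hirr), mul_one]
  have hord_unit : ∀ {w : integralClosure 𝒪[F] E}, IsUnit w → ord 𝔔 w = 0 := fun hw ↦
    (ord_eq_zero_iff 𝔔).mpr fun h ↦ h𝔔max.ne_top (Ideal.eq_top_of_isUnit_mem _ h hw)
  have hepos : 0 < e := Nat.card_pos
  -- §2: `(ζ - 1)^(p-1) = p w`
  obtain ⟨w, hw, hζw⟩ := exists_isUnit_sub_one_pow_eq_natCast_mul_of_isPrimitiveRoot hζ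
  have hordζ : ((p - 1 : ℕ) : ℕ∞) * ord 𝔔 (ζ - 1) = e := by
    rw [← ord_pow 𝔔 h𝔔0, hζw, ord_mul 𝔔 h𝔔0, hord_unit hw, add_zero, hordp]
  -- Bezout: `a (p-1) c = 1 + b p`
  have hcop : ((p - 1) * c).Coprime p := by
    refine Nat.Coprime.mul_left ?_ ?_
    · refine Nat.Coprime.symm ((Nat.Prime.coprime_iff_not_dvd hp1).mpr ?_)
      exact Nat.not_dvd_of_pos_of_lt (Nat.sub_pos_of_lt hp1.one_lt) (Nat.sub_lt hp1.pos one_pos)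
    · exact Nat.Coprime.symm ((Nat.Prime.coprime_iff_not_dvd hp1).mpr hc)
  obtain ⟨a, -, ha⟩ := Nat.exists_mul_mod_eq_one_of_coprime hcop hp1.one_lt
  set b := (p - 1) * c * a / p with hbdef
  have hab : a * ((p - 1) * c) = 1 + b * p := by
    have h := Nat.div_add_mod ((p - 1) * c * a) p
    rw [ha] at h
    rw [hbdef, mul_comm a]
    linarith [h]
  have hpa : ¬ p ∣ a := by
    intro h
    have h2 : p ∣ 1 + b * p := hab ▸ dvd_mul_of_dvd_left h _
    exact hp1.not_dvd_one ((Nat.dvd_add_left (dvd_mul_left p b)).mp h2)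
  /- ### the elements in the field `E` -/
  haveI : CharZero E := charZero_of_injective_algebraMap (algebraMap F E).injective
  haveI : NeZero p := ⟨hp1.ne_zero⟩
  have hζE : IsPrimitiveRoot ((ζ : integralClosure 𝒪[F] E) : E) p :=
    hζ.map_of_injective (f := (integralClosure 𝒪[F] E).val) Subtype.val_injective
  have hζ1 : ((ζ : integralClosure 𝒪[F] E) : E) - 1 ≠ 0 := sub_ne_zero.mpr (hζE.ne_one hp1.one_lt)
  have hp0E : (p : E) ≠ 0 := Nat.cast_ne_zero.mpr hp1.ne_zero
  have hpS : ((p : integralClosure 𝒪[F] E) : E) = (p : E) := map_natCast (integralClosure 𝒪[F] E).val p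
  have hvE : algebraMap 𝒪[F] E (v : 𝒪[F]) ≠ 0 := (v.isUnit.map (algebraMap 𝒪[F] E)).ne_zero
  have hyE : ((y : integralClosure 𝒪[F] E) : E) ^ p =
      algebraMap 𝒪[F] E (v : 𝒪[F]) * (p : E) ^ c := by
    have h := congrArg (fun z : integralClosure 𝒪[F] E ↦ (z : E)) hy
    simp only [SubmonoidClass.coe_pow, map_mul, map_pow, map_natCast] at h
    exact h
  have hy0 : ((y : integralClosure 𝒪[F] E) : E) ≠ 0 := by
    intro h
    have h' := hyE
    rw [h, zero_pow hp1.ne_zero] at h'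
    exact (mul_ne_zero hvE (pow_ne_zero _ hp0E)) h'.symm
  have hwE : ((w : integralClosure 𝒪[F] E) : E) ≠ 0 := by
    obtain ⟨w', hw'⟩ := hw.exists_left_inv
    intro h
    have := congrArg (fun z : integralClosure 𝒪[F] E ↦ (z : E)) hw'
    simp only [Subalgebra.coe_mul, h, mul_zero, Subalgebra.coe_one] at this
    exact zero_ne_one this
  have hζwE : (((ζ : integralClosure 𝒪[F] E) : E) - 1) ^ (p - 1) = (p : E) * (w : E) := by
    have h := congrArg (fun z : integralClosure 𝒪[F] E ↦ (z : E)) hζw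
    simpa only [SubmonoidClass.coe_pow, AddSubgroupClass.coe_sub, Subalgebra.coe_one,
      Subalgebra.coe_mul, hpS] using h
  /- ### `#G ≤ (p-1)·p`: `g ↦ (g ζ, g y)` is injective into (primitive roots) × (roots of `X^p - x`) -/
  have hcardG : Nat.card (E ≃ₐ[F] E) ≤ (p - 1) * p := by
    let f : (E ≃ₐ[F] E) → (primitiveRoots p E) ×
        ((Polynomial.nthRoots p (algebraMap 𝒪[F] E (v : 𝒪[F]) * (p : E) ^ c)).toFinset) :=
      fun g ↦ (⟨g ((ζ : integralClosure 𝒪[F] E) : E),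
          (mem_primitiveRoots hp1.pos).mpr (hζE.map_of_injective g.injective)⟩,
        ⟨g ((y : integralClosure 𝒪[F] E) : E), by
          rw [Multiset.mem_toFinset, Polynomial.mem_nthRoots hp1.pos, ← map_pow, hyE, map_mul, map_pow,
            map_natCast, IsScalarTower.algebraMap_apply 𝒪[F] F E, AlgEquiv.commutes]⟩)
    have hf : Function.Injective f := by
      intro g₁ g₂ hg
      have h1 : g₁ ((ζ : integralClosure 𝒪[F] E) : E) = g₂ ((ζ : integralClosure 𝒪[F] E) : E) :=
        congrArg Subtype.val (congrArg Prod.fst hg)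
      have h2 : g₁ ((y : integralClosure 𝒪[F] E) : E) = g₂ ((y : integralClosure 𝒪[F] E) : E) :=
        congrArg Subtype.val (congrArg Prod.snd hg)
      have h3 : g₂⁻¹ * g₁ = 1 := by
        refine hgen _ (Subtype.ext ?_) (Subtype.ext ?_)
        · rw [integralClosure.coe_smul, AlgEquiv.smul_def, AlgEquiv.mul_apply, h1, AlgEquiv.aut_inv,
            AlgEquiv.symm_apply_apply]
        · rw [integralClosure.coe_smul, AlgEquiv.smul_def, AlgEquiv.mul_apply, h2, AlgEquiv.aut_inv,
            AlgEquiv.symm_apply_apply]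
      exact (inv_mul_eq_one.mp h3).symm
    calc Nat.card (E ≃ₐ[F] E)
        ≤ Nat.card ((primitiveRoots p E) ×
            ((Polynomial.nthRoots p (algebraMap 𝒪[F] E (v : 𝒪[F]) * (p : E) ^ c)).toFinset)) :=
          Nat.card_le_card_of_injective f hf
      _ = (primitiveRoots p E).card *
            (Polynomial.nthRoots p (algebraMap 𝒪[F] E (v : 𝒪[F]) * (p : E) ^ c)).toFinset.card := by
          rw [Nat.card_prod, Nat.card_eq_finsetCard, Nat.card_eq_finsetCard]
      _ ≤ (p - 1) * p := by
          refine Nat.mul_le_mul ?_ ?_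
          · rw [hζE.card_primitiveRoots, Nat.totient_prime hp1]
          · exact (Multiset.toFinset_card_le _).trans (Polynomial.card_nthRoots _ _)
  have hele : e ≤ p * (p - 1) := by
    calc e ≤ Nat.card (E ≃ₐ[F] E) := Subgroup.card_le_card_group _
      _ ≤ (p - 1) * p := hcardG
      _ = p * (p - 1) := Nat.mul_comm _ _
  /- ### the uniformiser `π = y^a / (ζ - 1)^b` -/
  set N := p * (p - 1) with hNdef
  have hNpos : 0 < N := Nat.mul_pos hp1.pos (Nat.sub_pos_of_lt hp1.one_lt)
  set πE : E := ((y : integralClosure 𝒪[F] E) : E) ^ a /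
    (((ζ : integralClosure 𝒪[F] E) : E) - 1) ^ b with hπEdef
  have hπE0 : πE ≠ 0 := div_ne_zero (pow_ne_zero _ hy0) (pow_ne_zero _ hζ1)
  -- `π^N · w^{bp} = v^{a(p-1)} · p` in `E`
  have hkeyE : πE ^ N * ((w : integralClosure 𝒪[F] E) : E) ^ (b * p) =
      (algebraMap 𝒪[F] E (v : 𝒪[F])) ^ (a * (p - 1)) * (p : E) := by
    have h1 : πE ^ N * ((((ζ : integralClosure 𝒪[F] E) : E) - 1) ^ b) ^ N =
        (((y : integralClosure 𝒪[F] E) : E) ^ a) ^ N := by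
      rw [hπEdef, div_pow, div_mul_cancel₀ _ (pow_ne_zero _ (pow_ne_zero _ hζ1))]
    have h2 : (((y : integralClosure 𝒪[F] E) : E) ^ a) ^ N =
        (algebraMap 𝒪[F] E (v : 𝒪[F])) ^ (a * (p - 1)) * (p : E) ^ (1 + b * p) := by
      rw [← pow_mul, show a * N = p * (a * (p - 1)) by rw [hNdef]; ring, pow_mul, hyE, mul_pow,
        ← pow_mul, show c * (a * (p - 1)) = a * ((p - 1) * c) by ring, hab]
    have h3 : ((((ζ : integralClosure 𝒪[F] E) : E) - 1) ^ b) ^ N =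
        (p : E) ^ (b * p) * ((w : integralClosure 𝒪[F] E) : E) ^ (b * p) := by
      rw [← pow_mul, show b * N = (p - 1) * (b * p) by rw [hNdef]; ring, pow_mul, hζwE, mul_pow]
    have h4 : (πE ^ N * ((w : integralClosure 𝒪[F] E) : E) ^ (b * p)) * (p : E) ^ (b * p) =
        ((algebraMap 𝒪[F] E (v : 𝒪[F])) ^ (a * (p - 1)) * (p : E)) * (p : E) ^ (b * p) := by
      calc (πE ^ N * ((w : integralClosure 𝒪[F] E) : E) ^ (b * p)) * (p : E) ^ (b * p)
          = πE ^ N * ((((ζ : integralClosure 𝒪[F] E) : E) - 1) ^ b) ^ N := by rw [h3]; ring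
        _ = (((y : integralClosure 𝒪[F] E) : E) ^ a) ^ N := h1
        _ = _ := by rw [h2]; ring
    exact mul_right_cancel₀ (pow_ne_zero _ hp0E) h4
  -- `π` is integral: `π^N ∈ S`
  obtain ⟨u, hu⟩ := hw
  have huE : ((↑(u⁻¹) : integralClosure 𝒪[F] E) : E) = (((w : integralClosure 𝒪[F] E) : E))⁻¹ := by
    have h := congrArg (fun z : integralClosure 𝒪[F] E ↦ (z : E)) u.inv_mul
    simp only [Subalgebra.coe_mul, Subalgebra.coe_one, hu] at h
    exact (eq_inv_of_mul_eq_one_left h)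
  have hπN : πE ^ N = ((algebraMap 𝒪[F] (integralClosure 𝒪[F] E) (v : 𝒪[F]) ^ (a * (p - 1)) *
      (p : integralClosure 𝒪[F] E) * (↑(u⁻¹) : integralClosure 𝒪[F] E) ^ (b * p) :
        integralClosure 𝒪[F] E) : E) := by
    simp only [Subalgebra.coe_mul, SubmonoidClass.coe_pow, Subalgebra.coe_algebraMap, hpS, huE,
      inv_pow]
    rw [← hkeyE, mul_inv_cancel_right₀ (pow_ne_zero _ hwE)]
  have hπint : IsIntegral 𝒪[F] πE := by
    refine IsIntegral.of_pow hNpos ?_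
    rw [hπN]
    exact Subtype.prop _
  set π : integralClosure 𝒪[F] E := ⟨πE, hπint⟩ with hπdef
  have hπcoe : ((π : integralClosure 𝒪[F] E) : E) = πE := rfl
  have hπ0 : π ≠ 0 := fun h ↦ hπE0 (by rw [← hπcoe, h]; rfl)
  -- the identity in `S` and the order of `π`
  have hkeyS : π ^ N * w ^ (b * p) =
      algebraMap 𝒪[F] (integralClosure 𝒪[F] E) (v : 𝒪[F]) ^ (a * (p - 1)) *
        (p : integralClosure 𝒪[F] E) := by
    apply Subtype.ext
    simp only [Subalgebra.coe_mul, SubmonoidClass.coe_pow, Subalgebra.coe_algebraMap, hpS, hπcoe]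
    exact hkeyE
  have hvS : IsUnit (algebraMap 𝒪[F] (integralClosure 𝒪[F] E) (v : 𝒪[F])) :=
    v.isUnit.map _
  have hordπN : (N : ℕ∞) * ord 𝔔 π = e := by
    have h := congrArg (ord 𝔔) hkeyS
    rwa [ord_mul 𝔔 h𝔔0, ord_pow 𝔔 h𝔔0, ord_pow 𝔔 h𝔔0, hord_unit ⟨u, hu⟩, mul_zero, add_zero,
      ord_mul 𝔔 h𝔔0, ord_pow 𝔔 h𝔔0, hord_unit hvS, mul_zero, zero_add, hordp] at h
  obtain ⟨k, hk⟩ := exists_ord_eq_natCast 𝔔 h𝔔0 hπ0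
  have hNk : N * k = e := by
    rw [hk, ← Nat.cast_mul] at hordπN
    exact_mod_cast hordπN
  have hk1 : k = 1 := by
    have hk0 : k ≠ 0 := fun h ↦ by rw [h, mul_zero] at hNk; exact hepos.ne' hNk.symm
    have : N * k ≤ N * 1 := by rw [hNk, mul_one]; exact hele
    have := Nat.le_of_mul_le_mul_left this hNpos
    omega
  have heN : e = N := by rw [← hNk, hk1, mul_one]
  have hordπ : ord 𝔔 π = 1 := by rw [hk, hk1]; rfl
  -- `v(ζ - 1) = p`
  have hordζ1 : ord 𝔔 (ζ - 1) = (p : ℕ∞) := by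
    have hζ0 : (ζ : integralClosure 𝒪[F] E) - 1 ≠ 0 := fun h ↦ hζ1 (by
      have := congrArg (fun z : integralClosure 𝒪[F] E ↦ (z : E)) h
      simpa using this)
    obtain ⟨m, hm⟩ := exists_ord_eq_natCast 𝔔 h𝔔0 hζ0
    rw [hm, heN, hNdef, ← Nat.cast_mul] at hordζ
    have h : (p - 1) * m = (p - 1) * p := by
      have := (Nat.cast_injective (R := ℕ∞)) hordζ
      rw [this]; ring
    rw [hm, Nat.eq_of_mul_eq_mul_left (Nat.sub_pos_of_lt hp1.one_lt) h]
  /- ### an inertia element of order `p` -/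
  have hpe : p ∣ Nat.card (𝔔.inertia (E ≃ₐ[F] E)) := ⟨p - 1, by rw [← hedef, heN]⟩
  obtain ⟨τ₀, hτ₀⟩ := exists_prime_orderOf_dvd_card' (G := 𝔔.inertia (E ≃ₐ[F] E)) p hpe
  set τ : E ≃ₐ[F] E := (τ₀ : E ≃ₐ[F] E) with hτdef
  have hτI : τ ∈ 𝔔.inertia (E ≃ₐ[F] E) := τ₀.2
  have hτord : orderOf τ = p := by rw [hτdef, Subgroup.orderOf_coe, hτ₀]
  have hτ1 : τ ≠ 1 := fun h ↦ hp1.one_lt.ne' (by rw [← hτord, h, orderOf_one])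
  -- `τ ζ = ζ`
  have hτζE : τ ((ζ : integralClosure 𝒪[F] E) : E) = ((ζ : integralClosure 𝒪[F] E) : E) := by
    set χ := IsPrimitiveRoot.autToPow F hζE with hχdef
    have h1 : orderOf (χ τ) ∣ p := hτord ▸ orderOf_map_dvd χ τ
    have h2 : orderOf (χ τ) ∣ p - 1 := by
      have h := orderOf_dvd_natCard (χ τ)
      rwa [Nat.card_eq_fintype_card, ZMod.card_units_eq_totient p, Nat.totient_prime hp1] at h
    have h3 : orderOf (χ τ) = 1 := by
      have hc : (p - 1).Coprime p := by
        refine Nat.Coprime.symm ((Nat.Prime.coprime_iff_not_dvd hp1).mpr ?_)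
        exact Nat.not_dvd_of_pos_of_lt (Nat.sub_pos_of_lt hp1.one_lt) (Nat.sub_lt hp1.pos one_pos)
      exact Nat.eq_one_of_dvd_coprimes hc h2 h1
    have h4 : χ τ = 1 := orderOf_eq_one_iff.mp h3
    have h5 := hζE.autToPow_spec F τ
    rw [← hχdef, h4, Units.val_one, ZMod.val_one p, pow_one] at h5
    exact h5.symm
  have hτζ : τ • ζ = ζ := Subtype.ext (by rw [integralClosure.coe_smul, AlgEquiv.smul_def, hτζE])
  -- `τ y = ζ^i y` with `ζ^i ≠ 1`
  have hτyp : (τ ((y : integralClosure 𝒪[F] E) : E)) ^ p = ((y : integralClosure 𝒪[F] E) : E) ^ p := by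
    rw [← map_pow, hyE, map_mul, map_pow, map_natCast, IsScalarTower.algebraMap_apply 𝒪[F] F E,
      AlgEquiv.commutes]
  obtain ⟨i, hip, hi⟩ : ∃ i < p, ((ζ : integralClosure 𝒪[F] E) : E) ^ i =
      τ ((y : integralClosure 𝒪[F] E) : E) * (((y : integralClosure 𝒪[F] E) : E))⁻¹ :=
    hζE.eq_pow_of_pow_eq_one (by rw [mul_pow, hτyp, inv_pow, mul_inv_cancel₀ (pow_ne_zero _ hy0)])
  have hτyE : τ ((y : integralClosure 𝒪[F] E) : E) =
      ((ζ : integralClosure 𝒪[F] E) : E) ^ i * ((y : integralClosure 𝒪[F] E) : E) := by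
    rw [hi, inv_mul_cancel_right₀ hy0]
  have hτy : τ • y = ζ ^ i * y := Subtype.ext (by
    rw [integralClosure.coe_smul, AlgEquiv.smul_def, hτyE, Subalgebra.coe_mul, SubmonoidClass.coe_pow])
  have hζi : ζ ^ i ≠ 1 := by
    intro h
    apply hτ1
    refine hgen τ hτζ ?_
    rw [hτy, h, one_mul]
  have hi0 : i ≠ 0 := fun h ↦ hζi (by rw [h, pow_zero])
  have hia : (i * a).Coprime p := by
    refine Nat.Coprime.mul_left ?_ ?_
    · exact Nat.Coprime.symm ((Nat.Prime.coprime_iff_not_dvd hp1).mpr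
        (Nat.not_dvd_of_pos_of_lt (Nat.pos_of_ne_zero hi0) hip))
    · exact Nat.Coprime.symm ((Nat.Prime.coprime_iff_not_dvd hp1).mpr hpa)
  -- `τ π = ζ^{ia} π`
  have hτπE : τ πE = ((ζ : integralClosure 𝒪[F] E) : E) ^ (i * a) * πE := by
    rw [hπEdef, map_div₀, map_pow, map_pow, map_sub, map_one, hτζE, hτyE, mul_pow, ← pow_mul,
      mul_div_assoc]
  have hτπ : τ • π - π = (ζ ^ (i * a) - 1) * π := Subtype.ext (by
    rw [AddSubgroupClass.coe_sub, integralClosure.coe_smul, AlgEquiv.smul_def, hπcoe, hτπE,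
      Subalgebra.coe_mul, AddSubgroupClass.coe_sub, SubmonoidClass.coe_pow, Subalgebra.coe_one, hπcoe]
    ring)
  -- `i_G(τ) = v(τπ - π) = p + 1`
  have hordτπ : ord 𝔔 (τ • π - π) = ((p + 1 : ℕ) : ℕ∞) := by
    rw [hτπ, ord_mul 𝔔 h𝔔0, ← ord_eq_of_associated 𝔔 (hζ.associated_sub_one_pow_sub_one_of_coprime hia),
      hordζ1, hordπ, Nat.cast_add, Nat.cast_one]
  have hπmem : π ∈ 𝔔 := by
    have h : π ∈ 𝔔 ^ 1 := (mem_pow_iff_le_ord 𝔔).mpr (by rw [hordπ]; exact le_rfl)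
    rwa [pow_one] at h
  have hπ2 : π ∉ 𝔔 ^ 2 := fun h ↦ by
    have h' := (mem_pow_iff_le_ord 𝔔).mp h
    rw [hordπ] at h'
    exact absurd h' (by decide)
  have hτGp : τ ∈ 𝔔.ramificationSubgroup (E ≃ₐ[F] E) p :=
    (mem_ramificationSubgroup_iff_of_mem_inertia (K := F) 𝔔 h𝔔0 hτI hπmem hπ2 p).mpr
      ((mem_pow_iff_le_ord 𝔔).mpr (by rw [hordτπ]))
  /- ### `#G_p ≥ p` and Herbrand -/
  have hGp : p ≤ Nat.card (𝔔.ramificationSubgroup (E ≃ₐ[F] E) p) := by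
    have hP1 : IsPGroup p (𝔔.ramificationSubgroup (E ≃ₐ[F] E) 1) := by
      have h := isPGroup_ramificationSubgroup_one_of_isGalois (F := F) E
      rwa [ringChar_residueField_eq_of_irreducible F hirr] at h
    have hPp : IsPGroup p (𝔔.ramificationSubgroup (E ≃ₐ[F] E) p) :=
      hP1.to_le (𝔔.ramificationSubgroup_antitone (E ≃ₐ[F] E) hp1.one_lt.le)
    obtain ⟨n, hn⟩ := hPp.exists_card_eq
    have hn0 : n ≠ 0 := by
      rintro rfl
      rw [pow_zero] at hn
      have hbot := Subgroup.eq_bot_of_card_eq _ hn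
      rw [hbot, Subgroup.mem_bot] at hτGp
      exact hτ1 hτGp
    rw [hn]
    exact Nat.le_self_pow hn0 p
  have hcard : Nat.card (𝔔.ramificationSubgroup (E ≃ₐ[F] E) 0) <
      p * Nat.card (𝔔.ramificationSubgroup (E ≃ₐ[F] E) p) := by
    rw [Ideal.ramificationSubgroup_zero, ← hedef, heN, hNdef]
    calc p * (p - 1) < p * p := Nat.mul_lt_mul_of_pos_left (Nat.sub_lt hp1.pos one_pos) hp1.pos
      _ ≤ p * Nat.card (𝔔.ramificationSubgroup (E ≃ₐ[F] E) p) := Nat.mul_le_mul_left p hGp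
  obtain ⟨u', hu', hτu⟩ :=
    exists_one_lt_mem_upperRamificationSubgroup 𝔔 (E ≃ₐ[F] E) hτGp hcard
  refine ⟨u', hu', τ, hτu, fun h ↦ hζi ?_⟩
  -- `τ y = ζ^i y = y` forces `ζ^i = 1`
  have h1 : (ζ ^ i - 1) * y = 0 := by rw [sub_mul, one_mul, ← hτy, h, sub_self]
  have hy0' : y ≠ 0 := fun h' ↦ hy0 (by rw [h']; rfl)
  exact sub_eq_zero.mp ((mul_eq_zero.mp h1).resolve_right hy0')

end Layer

/-! ### §4 The absolute statement: the Kummer extension by `v·p^c`, `p ∤ c`, is très ramifié -/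

section Absolute

open IsNonarchimedeanLocalField

variable (F : Type u) [Field F] [ValuativeRel F] [TopologicalSpace F] [IsNonarchimedeanLocalField F]
  [CharZero F]

set_option maxHeartbeats 800000 in
/-- **A Kummer extension by a non-unit class is *très ramifiée*** (Serre, Duke 54 (1987) §2.4; *Local
Fields* IV §§1–4).  Let `F` be a non-archimedean local field of characteristic `0` in which the prime
`p` is a UNIFORMISER (`F/ℚ_p` unramified), `x = v·p^c ∈ 𝒪_F` with `v` a unit and `p ∤ c`, and `y ∈ F̄`
with `y^p = x`.  Then some upper-numbering ramification group `I_F^u` with `u > 1` MOVES `y`: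
`∃ u > 1, ∃ σ ∈ I_F^u, σ y ≠ y`.  Equivalently: the mod-`p` representation `(ω κ_x; 0 1)` of `Γ_F`
cut out by `F(ζ_p, x^{1/p})` is très ramifiée; contrapositively, a *peu ramifié* Kummer class
`κ_x ∈ H¹(F, μ_p)` has `p ∣ v_F(x)`, i.e. is the class of a UNIT.  (The splitting field
`E = F(ζ_p, y)` has `e = p(p-1)` and upper break `φ_{E/F}(p) = p/(p-1) > 1`:
`exists_one_lt_mem_upperRamificationSubgroup_smul_ne_of_kummer`, lifted to `Γ_F` by Herbrand
`absUpperInertia_map_absRestrictNormalHom`.)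
[cite: Serre1987, §2.4 (peu/très ramifié), §2.8] [cite: SerreLocalFields1979, Ch. IV §1 Prop. 2–5, §2 Cor. 3, §3 Prop. 14 and Remark 1, §4] -/
theorem exists_one_lt_mem_absUpperInertia_smul_ne_of_pow_eq
    {p : ℕ} [hp : Fact p.Prime] (hirr : Irreducible ((p : ℕ) : 𝒪[F]))
    (v : 𝒪[F]ˣ) {c : ℕ} (hc : ¬ p ∣ c) {y : AlgebraicClosure F}
    (hy : y ^ p = algebraMap 𝒪[F] (AlgebraicClosure F) ((v : 𝒪[F]) * (p : 𝒪[F]) ^ c)) :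
    ∃ u : ℝ, 1 < u ∧ ∃ σ ∈ absUpperInertia F u, σ • y ≠ y := by
  classical
  have hp1 : p.Prime := hp.out
  haveI : NeZero p := ⟨hp1.ne_zero⟩
  set xO : 𝒪[F] := (v : 𝒪[F]) * (p : 𝒪[F]) ^ c with hxO
  set xF : F := algebraMap 𝒪[F] F xO with hxF
  have hxL : algebraMap 𝒪[F] (AlgebraicClosure F) xO = algebraMap F (AlgebraicClosure F) xF :=
    IsScalarTower.algebraMap_apply 𝒪[F] F (AlgebraicClosure F) xO
  have hxO0 : xO ≠ 0 := mul_ne_zero v.ne_zero (pow_ne_zero _ hirr.ne_zero)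
  have hxF0 : xF ≠ 0 := fun h ↦ hxO0 (IsFractionRing.injective 𝒪[F] F (by rw [← hxF, h, map_zero]))
  have hxL0 : algebraMap F (AlgebraicClosure F) xF ≠ 0 :=
    (map_ne_zero_iff _ (algebraMap F (AlgebraicClosure F)).injective).mpr hxF0
  have hyL : y ^ p = algebraMap F (AlgebraicClosure F) xF := by rw [hy, hxL]
  have hy0 : y ≠ 0 := by
    intro h
    rw [h, zero_pow hp1.ne_zero] at hyL
    exact hxL0 hyL.symm
  -- the polynomial `X^p - x` and its splitting field `E = F(ζ_p, y) ⊂ F̄`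
  set f : F[X] := X ^ p - C xF with hfdef
  have hf0 : f ≠ 0 := X_pow_sub_C_ne_zero hp1.pos xF
  have hfsep : f.Separable := separable_X_pow_sub_C xF (by exact_mod_cast hp1.ne_zero) hxF0
  set E : IntermediateField F (AlgebraicClosure F) :=
    IntermediateField.adjoin F (f.rootSet (AlgebraicClosure F)) with hEdef
  haveI hsplit : IsSplittingField F E f :=
    IntermediateField.adjoin_rootSet_isSplittingField (IsAlgClosed.splits _)
  haveI : FiniteDimensional F E := Polynomial.IsSplittingField.finiteDimensional E f
  haveI : IsGalois F E := IsGalois.of_separable_splitting_field hfsep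
  have hroot : ∀ z : AlgebraicClosure F, z ^ p = algebraMap F (AlgebraicClosure F) xF →
      z ∈ f.rootSet (AlgebraicClosure F) := fun z hz ↦ by
    rw [mem_rootSet]
    refine ⟨hf0, ?_⟩
    rw [hfdef, map_sub, map_pow, aeval_X, aeval_C, hz, sub_self]
  have hmemE : ∀ z : AlgebraicClosure F, z ^ p = algebraMap F (AlgebraicClosure F) xF → z ∈ E :=
    fun z hz ↦ IntermediateField.subset_adjoin F _ (hroot z hz)
  have hyE : y ∈ E := hmemE y hyL
  -- a primitive `p`-th root of unity, inside `E`
  obtain ⟨ζ, hζ⟩ : ∃ ζ : AlgebraicClosure F, IsPrimitiveRoot ζ p := by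
    obtain ⟨ζ, hζ⟩ := IsAlgClosed.exists_root (cyclotomic p (AlgebraicClosure F)) (by
      rw [degree_cyclotomic, Nat.totient_prime hp1]
      exact_mod_cast (Nat.sub_pos_of_lt hp1.one_lt).ne')
    exact ⟨ζ, isRoot_cyclotomic_iff.mp hζ⟩
  have hζy : (ζ * y) ^ p = algebraMap F (AlgebraicClosure F) xF := by
    rw [mul_pow, hζ.pow_eq_one, one_mul, hyL]
  have hζEmem : ζ ∈ E := by
    have h := E.mul_mem (hmemE _ hζy) (E.inv_mem hyE)
    rwa [mul_inv_cancel_right₀ hy0] at h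
  -- the elements of `E` and of `S = 𝒪_E`
  set yE : E := ⟨y, hyE⟩ with hyEdef
  set ζE : E := ⟨ζ, hζEmem⟩ with hζEdef
  have hζE : IsPrimitiveRoot ζE p :=
    hζ.of_map_of_injective (f := algebraMap E (AlgebraicClosure F)) (algebraMap E _).injective
  have hyEp : yE ^ p = algebraMap 𝒪[F] E xO := by
    apply Subtype.ext
    rw [SubmonoidClass.coe_pow]
    show y ^ p = ((algebraMap 𝒪[F] E xO : E) : AlgebraicClosure F)
    rw [hyL, IsScalarTower.algebraMap_apply 𝒪[F] F E, ← hxF]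
    rfl
  have hyint : IsIntegral 𝒪[F] yE :=
    IsIntegral.of_pow hp1.pos (by rw [hyEp]; exact isIntegral_algebraMap)
  have hζint : IsIntegral 𝒪[F] ζE :=
    IsIntegral.of_pow hp1.pos (by rw [hζE.pow_eq_one]; exact isIntegral_one)
  set yS : integralClosure 𝒪[F] E := ⟨yE, hyint⟩ with hySdef
  set ζS : integralClosure 𝒪[F] E := ⟨ζE, hζint⟩ with hζSdef
  have hζS : IsPrimitiveRoot ζS p :=
    hζE.of_map_of_injective (f := (integralClosure 𝒪[F] E).val) Subtype.val_injective
  have hyS : yS ^ p = algebraMap 𝒪[F] (integralClosure 𝒪[F] E) ((v : 𝒪[F]) * (p : 𝒪[F]) ^ c) :=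
    Subtype.ext (by rw [SubmonoidClass.coe_pow, Subalgebra.coe_algebraMap, ← hxO, ← hyEp])
  -- `E` is generated by `ζ` and `y`
  have hgen : ∀ g : E ≃ₐ[F] E, g • ζS = ζS → g • yS = yS → g = 1 := by
    intro g hgζ hgy
    have hgζE : g ζE = ζE := by
      have h := congrArg Subtype.val hgζ
      rwa [integralClosure.coe_smul, AlgEquiv.smul_def] at h
    have hgyE : g yE = yE := by
      have h := congrArg Subtype.val hgy
      rwa [integralClosure.coe_smul, AlgEquiv.smul_def] at h
    apply AlgEquiv.ext
    rintro ⟨z, hz⟩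
    refine IntermediateField.adjoin_induction F (p := fun x hx ↦ g ⟨x, hx⟩ = ⟨x, hx⟩)
      ?_ ?_ ?_ ?_ ?_ hz
    · intro x hx
      have hxp : x ^ p = algebraMap F (AlgebraicClosure F) xF := by
        rw [mem_rootSet] at hx
        have h := hx.2
        rw [hfdef, map_sub, map_pow, aeval_X, aeval_C, sub_eq_zero] at h
        exact h
      obtain ⟨j, -, hj⟩ : ∃ j < p, ζ ^ j = x * y⁻¹ :=
        hζ.eq_pow_of_pow_eq_one (by rw [mul_pow, inv_pow, hxp, hyL, mul_inv_cancel₀ hxL0])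
      have hx' : ∀ h : x ∈ E, (⟨x, h⟩ : E) = ζE ^ j * yE := fun h ↦ Subtype.ext (by
        rw [IntermediateField.coe_mul, IntermediateField.coe_pow]
        show x = ζ ^ j * y
        rw [hj, inv_mul_cancel_right₀ hy0])
      rw [hx', map_mul, map_pow, hgζE, hgyE]
    · intro r
      have h : (⟨algebraMap F (AlgebraicClosure F) r, IntermediateField.algebraMap_mem _ r⟩ : E) =
          algebraMap F E r := rfl
      rw [h, AlgEquiv.commutes]
    · intro a b ha hb iha ihb
      have h : (⟨a + b, add_mem ha hb⟩ : E) = ⟨a, ha⟩ + ⟨b, hb⟩ := rfl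
      rw [h, map_add, iha, ihb]
    · intro a ha iha
      have h : (⟨a⁻¹, inv_mem ha⟩ : E) = (⟨a, ha⟩ : E)⁻¹ := rfl
      rw [h, map_inv₀, iha]
    · intro a b ha hb iha ihb
      have h : (⟨a * b, mul_mem ha hb⟩ : E) = ⟨a, ha⟩ * ⟨b, hb⟩ := rfl
      rw [h, map_mul, iha, ihb]
  -- the layer computation, lifted to `Γ_F` by Herbrand
  obtain ⟨u, hu, τ, hτ, hτy⟩ :=
    exists_one_lt_mem_upperRamificationSubgroup_smul_ne_of_kummer F E hirr v hc hζS hyS hgen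
  have hmap := absUpperInertia_map_absRestrictNormalHom_holds F E u (zero_le_one.trans hu.le)
  rw [← hmap] at hτ
  obtain ⟨σ, hσ, hστ⟩ := Subgroup.mem_map.mp hτ
  refine ⟨u, hu, σ, hσ, fun hσy ↦ hτy (Subtype.ext ?_)⟩
  rw [integralClosure.coe_smul, AlgEquiv.smul_def, ← hστ]
  apply Subtype.ext
  show (((AlgEquiv.restrictNormalHom E (absoluteGaloisGroup.toAlgEquiv F σ)) yE : E) :
      AlgebraicClosure F) = y
  have h := AlgEquiv.restrictNormal_commutes (absoluteGaloisGroup.toAlgEquiv F σ) E yE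
  exact h.trans hσy

/-- **Contrapositive («peu ramifié ⇒ unit class», exponent form).**  With `F`, `p`, `x = v·p^c` and
`y^p = x` as above: if every upper ramification group `I_F^u`, `u > 1`, FIXES `y` (e.g. because a mod-`p`
representation through whose kernel `y` is fixed is peu ramifiée), then `p ∣ c`.
[cite: Serre1987, §2.4 (peu ramifié ⟺ the Kummer generators are units)] [cite: SerreLocalFields1979, Ch. IV §3] -/
theorem dvd_of_forall_absUpperInertia_smul_eq
    {p : ℕ} [hp : Fact p.Prime] (hirr : Irreducible ((p : ℕ) : 𝒪[F]))
    (v : 𝒪[F]ˣ) {c : ℕ} {y : AlgebraicClosure F}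
    (hy : y ^ p = algebraMap 𝒪[F] (AlgebraicClosure F) ((v : 𝒪[F]) * (p : 𝒪[F]) ^ c))
    (h : ∀ u : ℝ, 1 < u → ∀ σ ∈ absUpperInertia F u, σ • y = y) : p ∣ c := by
  by_contra hc
  obtain ⟨u, hu, σ, hσ, hne⟩ := exists_one_lt_mem_absUpperInertia_smul_ne_of_pow_eq F hirr v hc hy
  exact hne (h u hu σ hσ)

/-- **Contrapositive («peu ramifié ⇒ unit class», ring form).**  Let `p` be a uniformiser of `F`,
`x ∈ 𝒪_F ∖ {0}` and `y ∈ F̄` with `y^p = x`.  If every `I_F^u`, `u > 1`, fixes `y`, then `x = w · z^p` with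
`w ∈ 𝒪_F^×`, `z ∈ 𝒪_F` — i.e. `x` is a UNIT times a `p`-th power, so its Kummer class in
`H¹(F, μ_p) = F^×/F^{×p}` is the class of the unit `w` (`x = v p^c` with `p ∣ c`, `z = p^{c/p}`).
[cite: Serre1987, §2.4] [cite: SerreLocalFields1979, Ch. IV §3, Ch. II §3 (structure of a DVR)] -/
theorem exists_eq_unit_mul_pow_of_forall_absUpperInertia_smul_eq
    {p : ℕ} [hp : Fact p.Prime] (hirr : Irreducible ((p : ℕ) : 𝒪[F]))
    {x : 𝒪[F]} (hx : x ≠ 0) {y : AlgebraicClosure F}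
    (hy : y ^ p = algebraMap 𝒪[F] (AlgebraicClosure F) x)
    (h : ∀ u : ℝ, 1 < u → ∀ σ ∈ absUpperInertia F u, σ • y = y) :
    ∃ (w : 𝒪[F]ˣ) (z : 𝒪[F]), x = (w : 𝒪[F]) * z ^ p := by
  obtain ⟨c, u, hu⟩ := IsDiscreteValuationRing.associated_pow_irreducible hx hirr
  -- `x = u⁻¹? ` : `Associated x (p ^ c)` gives `x * u = p ^ c`
  have hxv : x = ((u⁻¹ : 𝒪[F]ˣ) : 𝒪[F]) * (p : 𝒪[F]) ^ c := by
    rw [← hu, mul_comm x, ← mul_assoc, Units.inv_mul, one_mul]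
  have hdvd : p ∣ c := dvd_of_forall_absUpperInertia_smul_eq F hirr u⁻¹ (c := c) (by rw [hy, hxv]) h
  obtain ⟨d, rfl⟩ := hdvd
  exact ⟨u⁻¹, (p : 𝒪[F]) ^ d, by rw [hxv, ← pow_mul, mul_comm d p]⟩

end Absolute

end Literature.NumberTheory.GaloisRepresentations

end
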